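import Summits.RiemannHypothesis.RiemannHypothesis.Theorems.OddSectorOddOneSignedWindowsOddEulerLagrange
import Summits.RiemannHypothesis.RiemannHypothesis.Theorems.OddSectorOddOneSignedWindowsThetaVectorEnergy
import HarnessLib

/-!
# Barta's identity for odd-sector ground states: the weak Euler–Lagrange equation against the
# odd theta vector `H_a` (helper for crux `OddSector.OddOneSignedWindows`, item stmt-RiemannHypothesis-17778; RH-free)

The route `OddSector` converts the SIGN of an odd ground state `u` of the crux into a floor for
`ε_od(a)` through Barta's inequality, whose identity half is the pairing of `u` with the odd theta
vector `H_a = −Φ′𝟙_{[-a,a]}` (`weilOddThetaVector a`): `ε_od(a)⟨u, H_a⟩ = B(u, H_a)`, `B` the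
hermitian form of the window. `H_a` is not a test function, so the weak equation along
approximating test sequences does not reach it; but `H_a` lies in the odd FORM DOMAIN
(`integrableOn_archEnergy_weilOddThetaVector`), and the form-domain weak Euler–Lagrange equation
(`oddGroundState_eulerLagrange_formDomain`) applies. This file records the instance
(`oddGroundState_barta_identity`): for every odd-sector ground state `u` at `a`,

  `P(u, H_a) + Σ_{log n < 2a} Λ(n) n^{-1/2} D_{log n}(u, H_a) + ∫₀^∞ ρ D_t(u, H_a) dt − M_a⟨u, H_a⟩
     = ε_od(a) ⟨u, H_a⟩`,

in the Markov-decomposed closed form of `Literature/NumberTheory/LFunctions/WeilMarkovQuadratic.lean`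
— RH-free and operator-free. (What remains for the Barta floor `OddBartaFloor` is the SUPERSOLUTION
inequality, i.e. the explicit evaluation and sign of the left side for one-signed `u`; not here.)

References: J. Barta, C. R. Acad. Sci. Paris 204 (1937); 2001 programme, route
`odd-sector-eigenfunction-sign`, results §§3–4 (Thm B); E. Bombieri (2000), §4 Lemma 1.
-/

noncomputable section

set_option linter.dupNamespace false

open MeasureTheory Set Filter
open scoped Topology ENNReal ComplexConjugate

namespace Summit.RiemannHypothesis.RiemannHypothesis.Theorems.OddSector

open Literature.NumberTheory.LFunctions

/-- **Barta's identity for an odd-sector ground state** (registered sub-goal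
`oddGroundState_barta_identity` of item stmt-RiemannHypothesis-17778): the form-domain weak
Euler–Lagrange equation of `u` against the odd theta vector `H_a` (which has finite energy).
[cite: Bombieri2000Weil, §4 Lemma 1 eq. (4.2)] -/
theorem oddGroundState_barta_identity :
    ∀ (a : ℝ) (u : ℝ → ℂ), IsWeilOddGroundState a u →
      2 * (∫ x, u x * (Real.cosh (x / 2) : ℂ)) *
            (starRingEnd ℂ) (∫ x, ((weilOddThetaVector a x : ℝ) : ℂ) * (Real.cosh (x / 2) : ℂ))
        - 2 * (∫ x, u x * (Real.sinh (x / 2) : ℂ)) *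
            (starRingEnd ℂ) (∫ x, ((weilOddThetaVector a x : ℝ) : ℂ) * (Real.sinh (x / 2) : ℂ))
        + (∑ n ∈ weilPrimeIndex a, (((ArithmeticFunction.vonMangoldt n : ℝ) / Real.sqrt n : ℝ) : ℂ) *
            ∫ x, (u (x + Real.log n) - u x) *
              (starRingEnd ℂ) (((weilOddThetaVector a (x + Real.log n) : ℝ) : ℂ) -
                ((weilOddThetaVector a x : ℝ) : ℂ)))
        + (∫ t in Ioi (0 : ℝ), (weilArchDensity t : ℂ) *
            ∫ x, (u (x + t) - u x) *
              (starRingEnd ℂ) (((weilOddThetaVector a (x + t) : ℝ) : ℂ) - ((weilOddThetaVector a x : ℝ) : ℂ)))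
        - (weilMarkovConstant a : ℂ) * ∫ x, u x * (starRingEnd ℂ) (((weilOddThetaVector a x : ℝ) : ℂ))
        = (weilOddGroundEnergy a : ℂ) *
            ∫ x, u x * (starRingEnd ℂ) (((weilOddThetaVector a x : ℝ) : ℂ)) := by
  intro a u hu
  have ha : 0 < a := hu.pos
  set H : ℝ → ℂ := fun x ↦ ((weilOddThetaVector a x : ℝ) : ℂ) with hH
  have hHm : MemLp H 2 := (memLp_weilOddThetaVector a 2).ofReal
  have hH0 : ∀ᵐ x : ℝ, x ∉ Icc (-a) a → H x = 0 := Eventually.of_forall fun x hx ↦ by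
    simp only [hH, weilOddThetaVector_of_not_mem hx, Complex.ofReal_zero]
  have hHo : ∀ᵐ x : ℝ, H (-x) = -H x := Eventually.of_forall fun x ↦ by
    simp only [hH, weilOddThetaVector_neg, Complex.ofReal_neg]
  have hHE := integrableOn_archEnergy_weilOddThetaVector a ha
  exact oddGroundState_eulerLagrange_formDomain a u hu H hHm hH0 hHo hHE

end Summit.RiemannHypothesis.RiemannHypothesis.Theorems.OddSector

end
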